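import Literature.NumberTheory.Automorphic.RestrictedTensorProductQuotient
import Literature.RepresentationTheory.TwistedCoinvariants
import HarnessLib

/-!
# Coinvariants of a restricted tensor product representation are `⊗'` of the local coinvariants

Topic `NumberTheory/Automorphic`.  Continuation of `RestrictedTensorProductQuotient.lean` (quotients of a model
`(W, j)` of `⊗'_i (V i, x₀ i)` by slotwise-generated submodules are restricted tensor products of the quotients) for
the tree's twisted coinvariants (`Literature/RepresentationTheory/TwistedCoinvariants.lean`:
`TwistedCoinv.Coinv ρ χ = S ⧸ TwistedCoinv.ker ρ χ`, the maximal quotient on which a group acts through a character;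
`TwistedCoinv.mk`, `TwistedCoinv.rep`).

## What is proved (Flath 1979, §2 and Example 2; the right-exactness step of Bernstein–Zelevinsky 1977, §4.7)

For a restricted tensor product representation `σ = ⊗'_i ρW i` of the restricted product `Πʳ i, [H i, KH i]` on a
model `(W, j)` (`IsRestrictedTensorProductRep ρW σ hx₀ j S₀`), local characters `χloc i : H i →* kˣ` trivial on
`KH i` for almost all `i`, and a character `χ` of the restricted product with `χ g = ∏_i χloc i (g i)` (`hχ`):
* `IsRestrictedTensorProductRep.apply_update_mem_ker` — LOCAL RELATIONS ARE GLOBAL: every slotwise image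
  `j (x; i ↦ n)`, `n ∈ TwistedCoinv.ker (ρW i) (χloc i)`, lies in `TwistedCoinv.ker σ χ` (for the generators it is
  the global relation of the element `mulSingle i g` of the restricted product; the slot map is linear);
* `IsRestrictedTensorProductRep.ker_le_span` — GLOBAL RELATIONS ARE GENERATED SLOT BY SLOT: `TwistedCoinv.ker σ χ`
  lies in the span of those slotwise images (`σ g (j x) − χ g • j x = j (g • x) − (∏_i χloc i (g i)) • j x` and
  `g • x` differs from `x` in finitely many slots: telescope, `RestrictedFamily.sub_prod_smul_mem_of_slotwise`);
* `IsRestrictedTensorProductRep.exists_coinvMap` — the comparison map `J` from restricted families of LOCAL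
  coinvariant classes to the GLOBAL coinvariants, `J ([x i])_i = [j x]`;
* `IsRestrictedTensorProductRep.isRestrictedTensorProduct_coinv` — **over a field, `(TwistedCoinv.Coinv σ χ, J)` is a
  restricted tensor product of the local coinvariants `(TwistedCoinv.Coinv (ρW i) (χloc i), [x₀ i])`**, with
  exceptional set any finite `S₁` off which the base class survives, `[x₀ i] ≠ 0` (the «unramified vector» input);
* `IsRestrictedTensorProductRep.commute`, `….eventually_mk_mem_fixedPoints`, `….coinv` — the same AS
  REPRESENTATIONS of a second restricted product `Πʳ i, [G i, K i]` acting on `W` through `πV = ⊗'_i ρV i` for local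
  families `ρV i` commuting with the `ρW i` (a dual pair, slot by slot):
  `IsRestrictedTensorProductRep (fun i => TwistedCoinv.rep (χloc i) (ρV i) _) (TwistedCoinv.rep χ πV _) _ J S₁` —
  «`Coinv_{∏'_v H_v, ⊗χ_v} (⊗'_v S_v) ≅ ⊗'_v Coinv_{H_v, χ_v} (S_v)` as `∏'_v G_v`-modules».

## Why (the consumer)

[Liu2021, Def. 4.11] (FJcycle.tex l. 2092–2096) DEFINES the adèlic oscillator representation `ω(μ,ε,χ)` of
`𝔾(𝔸_F^∞)` as the restricted tensor product `⊗'_v ω(μ_v,ε_v,χ_v)` of the LOCAL maximal `χ_v`-quotients of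
App. D §D.1 Step 3, while a model presenting the global object as the `χ`-coinvariants of the GLOBAL finite-adèlic
Weil representation `⊗'_v ω(μ_v,ε_v)` under the centre `∏'_v E_v¹` (the Hodge/CM cell's ω-carrier
`TwistedCoinv.Coinv (finPairRepW …) χ`, with `U(V)(𝔸_F^∞)` acting through `TwistedCoinv.rep`) owes exactly the
identification proved here; its one displayed local input is the survival of the unramified vector in the local
quotient (Def. 4.11 «unramified for all but finitely many `v`» with App. D Lem. D.1 (1); tree
`Liu2021/AdelicOscillatorNonvanishingAsPrinted.lean`, `RestrictedTensorProductCoinvariantsNonvanishing.lean`).  No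
statement of this file mentions Weil representations: everything is linear algebra of restricted tensor products.
Theorems only (`J` is delivered as an existential with its defining property and every statement holds for ANY such
`J`; the commuting and fixed-vector hypotheses of `coinv` are arbitrary proofs, supplied by `commute` and
`eventually_mk_mem_fixedPoints`); no definition, no named fact, no instance, no `sorry`.

## References

* D. Flath, *Decomposition of representations into tensor products*, Proc. Sympos. Pure Math. 33 (1979), part 1,
  179–183, §2 and Example 2. [Flath1979]
* I. N. Bernstein, A. V. Zelevinsky, *Induced representations of reductive `p`-adic groups I*, Ann. Sci. ÉNS 10
  (1977), §4.7. [BernsteinZelevinskyASENS1977]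
* Y. Liu, *Fourier–Jacobi cycles and arithmetic relative trace formula*, Camb. J. Math. 9 (2021) = arXiv:2102.11518,
  Def. 4.11 (l. 2083–2097), App. D §D.1 (l. 5209–5238) — context only. [Liu2021]
-/

noncomputable section

open scoped RestrictedProduct TensorProduct
open Filter PiTensorProduct Function

namespace Literature.NumberTheory.Automorphic

universe u uk uG uH v w

/-! ### §1 Local and global relations; the comparison map -/

section Coinv

open Literature.RepresentationTheory

variable {ι : Type u} {k : Type uk} [CommRing k] {H : ι → Type uH} [∀ i, Group (H i)]
  {KH : ∀ i, Subgroup (H i)} {V : ι → Type v} [∀ i, AddCommGroup (V i)] [∀ i, Module k (V i)]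
  {ρW : ∀ i, Representation k (H i) (V i)} {x₀ : ∀ i, V i} [DecidableEq ι]
  {W : Type w} [AddCommGroup W] [Module k W] {j : RestrictedFamily V x₀ → W} {S₀ : Finset ι}
  {hx₀ : ∀ᶠ i in cofinite, x₀ i ∈ (ρW i).fixedPoints (KH i)}
  {σ : Representation k (Πʳ i, [H i, KH i]) W}

/-- The element of the restricted product supported at one slot acts on restricted families in that slot only:
`(mulSingle i g) • (x; i ↦ v) = (x; i ↦ ρW i g v)` (a private copy of the lemma of `AutomorphicGLnFlathProofs`, kept
private to avoid the heavy import). [folklore] -/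
private theorem RestrictedFamily.smul_mulSingle_update' (x : RestrictedFamily V x₀) (i : ι) (g : H i) (v : V i) :
    RestrictedFamily.smul ρW hx₀ (RestrictedProduct.mulSingle KH i g) (x.update i v) =
      x.update i (ρW i g v) := by
  ext l
  rw [RestrictedFamily.smul_apply]
  by_cases hl : l = i
  · subst hl
    simp
  · simp [Pi.mulSingle_eq_of_ne hl, Function.update_of_ne hl]

/-- **Local relations are global relations.**  For a restricted tensor product representation `σ = ⊗'_i ρW i` of
`Πʳ i, [H i, KH i]` on `(W, j)` and a character `χ` of the restricted product with `χ g = ∏_i χloc i (g i)`: every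
slotwise image `j (x; i ↦ n)` of a local relation `n ∈ TwistedCoinv.ker (ρW i) (χloc i)` is a global relation —
for the generators `ρW i g v − χloc i g • v` it is the global relation of the element `mulSingle i g` of the
restricted product acting on `j (x; i ↦ v)`, and the slot map is linear. [cite: Flath1979, §2  Example 2] -/
theorem IsRestrictedTensorProductRep.apply_update_mem_ker (hσ : IsRestrictedTensorProductRep ρW σ hx₀ j S₀)
    (χloc : ∀ i, H i →* kˣ) (χ : (Πʳ i, [H i, KH i]) →* kˣ)
    (hχ : ∀ g : Πʳ i, [H i, KH i], ((χ g : kˣ) : k) = ∏ᶠ i, ((χloc i (g i) : kˣ) : k))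
    (x : RestrictedFamily V x₀) (i : ι) {n : V i} (hn : n ∈ TwistedCoinv.ker (ρW i) (χloc i)) :
    j (x.update i n) ∈ TwistedCoinv.ker σ χ := by
  suffices hle : TwistedCoinv.ker (ρW i) (χloc i) ≤
      (TwistedCoinv.ker σ χ).comap (hσ.isRestrictedTensorProduct.isRestrictedMultilinear.slot x i) from hle hn
  rw [TwistedCoinv.ker, Submodule.span_le]
  rintro _ ⟨⟨g, v⟩, rfl⟩
  rw [SetLike.mem_coe, Submodule.mem_comap, IsRestrictedMultilinear.slot_apply]
  dsimp only
  rw [hσ.isRestrictedTensorProduct.isRestrictedMultilinear.apply_update_sub,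
    hσ.isRestrictedTensorProduct.isRestrictedMultilinear.map_update_smul]
  have hχδ : ((χ (RestrictedProduct.mulSingle KH i g) : kˣ) : k) = ((χloc i g : kˣ) : k) := by
    rw [hχ, finprod_eq_single _ i (fun l hl => by simp [Pi.mulSingle_eq_of_ne hl])]
    simp
  have hgen := TwistedCoinv.sub_mem_ker σ χ (RestrictedProduct.mulSingle KH i g) (j (x.update i v))
  rw [← hσ.map_smul, RestrictedFamily.smul_mulSingle_update' x i g v, hχδ] at hgen
  simpa using hgen

/-- **Global relations are generated slot by slot.**  With `χ g = ∏_i χloc i (g i)` and `χloc i` trivial on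
`KH i` for almost all `i`: the relation submodule `span {σ g w − χ g • w}` of the `χ`-coinvariants of `⊗'_i ρW i` is
contained in the span of the slotwise images `j (x; i ↦ n)`, `n ∈ TwistedCoinv.ker (ρW i) (χloc i)`.  (By linearity
`w = j x`; then `σ g (j x) − χ g • j x = j (g • x) − (∏_i χloc i (g i)) • j x`, and `g • x` differs from `x` in
finitely many slots — telescope, `sub_prod_smul_mem_of_slotwise`.) [cite: Flath1979, §2  Example 2] -/
theorem IsRestrictedTensorProductRep.ker_le_span (hσ : IsRestrictedTensorProductRep ρW σ hx₀ j S₀)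
    (χloc : ∀ i, H i →* kˣ) (χ : (Πʳ i, [H i, KH i]) →* kˣ)
    (hχ : ∀ g : Πʳ i, [H i, KH i], ((χ g : kˣ) : k) = ∏ᶠ i, ((χloc i (g i) : kˣ) : k))
    (hχK : ∀ᶠ i in cofinite, ∀ g ∈ KH i, χloc i g = 1) :
    TwistedCoinv.ker σ χ ≤ Submodule.span k {w | ∃ (x : RestrictedFamily V x₀) (i : ι) (n : V i),
      n ∈ TwistedCoinv.ker (ρW i) (χloc i) ∧ j (x.update i n) = w} := by
  classical
  set P := Submodule.span k {w | ∃ (x : RestrictedFamily V x₀) (i : ι) (n : V i),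
      n ∈ TwistedCoinv.ker (ρW i) (χloc i) ∧ j (x.update i n) = w} with hP
  have hj := hσ.isRestrictedTensorProduct.isRestrictedMultilinear
  -- the case `w = j x`
  have hgen : ∀ (g : Πʳ i, [H i, KH i]) (x : RestrictedFamily V x₀),
      σ g (j x) - ((χ g : kˣ) : k) • j x ∈ P := fun g x => by
    rw [← hσ.map_smul]
    obtain ⟨T₁, -, hT₁⟩ := RestrictedFamily.exists_finset_forall_apply_eq (∅ : Finset ι)
      ({x, RestrictedFamily.smul ρW hx₀ g x} : Finset (RestrictedFamily V x₀))
    have hfin : (mulSupport fun i => ((χloc i (g i) : kˣ) : k)).Finite := by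
      have hev : ∀ᶠ i in cofinite, ((χloc i (g i) : kˣ) : k) = 1 :=
        (hχK.and g.2).mono fun i hi => by rw [hi.1 (g i) hi.2, Units.val_one]
      exact (Filter.eventually_cofinite.1 hev).subset fun i hi => hi
    have hsub : (mulSupport fun i => ((χloc i (g i) : kˣ) : k)) ⊆ ↑(T₁ ∪ hfin.toFinset) := fun i hi =>
      Finset.mem_coe.2 (Finset.mem_union_right _ (hfin.mem_toFinset.2 hi))
    have key := RestrictedFamily.sub_prod_smul_mem_of_slotwise j P (fun i => ((χloc i (g i) : kˣ) : k)) x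
      (T₁ ∪ hfin.toFinset)
      (RestrictedFamily.smul ρW hx₀ g x)
      (fun i hi => by
        rw [hT₁ _ (by simp) i (fun h' => hi (Finset.mem_union_left _ h')),
          hT₁ x (by simp) i (fun h' => hi (Finset.mem_union_left _ h'))])
      (fun i _ y => by
        rw [RestrictedFamily.smul_apply, ← hj.map_update_smul, ← hj.apply_update_sub]
        exact Submodule.subset_span ⟨y, i, _, TwistedCoinv.sub_mem_ker (ρW i) (χloc i) (g i) (x i), rfl⟩)
    rwa [← finprod_eq_prod_of_mulSupport_subset _ hsub, ← hχ] at key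
  rw [TwistedCoinv.ker, Submodule.span_le]
  rintro _ ⟨⟨g, w⟩, rfl⟩
  dsimp only
  have hw : w ∈ Submodule.span k (Set.range j) := by
    rw [hσ.isRestrictedTensorProduct.span_range_eq_top]; trivial
  induction hw using Submodule.span_induction with
  | mem _ hx =>
    obtain ⟨x, rfl⟩ := hx
    exact hgen g x
  | zero => rw [map_zero, smul_zero, sub_self]; exact P.zero_mem
  | add a b _ _ ha hb =>
    rw [map_add, smul_add, add_sub_add_comm]
    exact P.add_mem ha hb
  | smul r a _ ha =>
    rw [_root_.map_smul, smul_comm, ← smul_sub]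
    exact P.smul_mem r ha

/-- **The comparison map exists for coinvariants**: there is `J` from the restricted families of LOCAL coinvariant
classes `(TwistedCoinv.Coinv (ρW i) (χloc i), [x₀ i])` to the GLOBAL coinvariants `TwistedCoinv.Coinv σ χ` of
`⊗'_i ρW i` with `J ([x i])_i = [j x]`. [cite: Flath1979, §2  Example 2] -/
theorem IsRestrictedTensorProductRep.exists_coinvMap (hσ : IsRestrictedTensorProductRep ρW σ hx₀ j S₀)
    (χloc : ∀ i, H i →* kˣ) (χ : (Πʳ i, [H i, KH i]) →* kˣ)
    (hχ : ∀ g : Πʳ i, [H i, KH i], ((χ g : kˣ) : k) = ∏ᶠ i, ((χloc i (g i) : kˣ) : k))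
    (hq : ∀ᶠ i in cofinite,
      TwistedCoinv.mk (ρW i) (χloc i) (x₀ i) = TwistedCoinv.mk (ρW i) (χloc i) (x₀ i)) :
    ∃ J : RestrictedFamily (fun i => TwistedCoinv.Coinv (ρW i) (χloc i))
        (fun i => TwistedCoinv.mk (ρW i) (χloc i) (x₀ i)) → TwistedCoinv.Coinv σ χ,
      ∀ x : RestrictedFamily V x₀,
        J (RestrictedFamily.piMap (x₀' := fun i => TwistedCoinv.mk (ρW i) (χloc i) (x₀ i))
          (fun i => TwistedCoinv.mk (ρW i) (χloc i)) hq x) = TwistedCoinv.mk σ χ (j x) :=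
  hσ.isRestrictedTensorProduct.isRestrictedMultilinear.exists_quotientMap
    (N := fun i => TwistedCoinv.ker (ρW i) (χloc i)) (M := TwistedCoinv.ker σ χ)
    (fun x i _ hn => hσ.apply_update_mem_ker χloc χ hχ x i hn) hq

end Coinv

/-! ### §2 The identification over a field -/

section CoinvField

open Literature.RepresentationTheory

variable {ι : Type u} {k : Type uk} [Field k] {H : ι → Type uH} [∀ i, Group (H i)]
  {KH : ∀ i, Subgroup (H i)} {V : ι → Type v} [∀ i, AddCommGroup (V i)] [∀ i, Module k (V i)]
  {ρW : ∀ i, Representation k (H i) (V i)} {x₀ : ∀ i, V i} [DecidableEq ι]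
  {W : Type w} [AddCommGroup W] [Module k W] {j : RestrictedFamily V x₀ → W} {S₀ : Finset ι}
  {hx₀ : ∀ᶠ i in cofinite, x₀ i ∈ (ρW i).fixedPoints (KH i)}
  {σ : Representation k (Πʳ i, [H i, KH i]) W}

/-- **Coinvariants of a restricted tensor product are the restricted tensor product of the local coinvariants.**
Over a field: for `σ = ⊗'_i ρW i` on the model `(W, j)`, local characters `χloc i` trivial on `KH i` for almost all
`i`, the global character `χ = ∏_i χloc i`, and any `J` with `J ([x i])_i = [j x]` (`exists_coinvMap`): the pair
`(TwistedCoinv.Coinv σ χ, J)` is a restricted tensor product of the local coinvariants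
`(TwistedCoinv.Coinv (ρW i) (χloc i), [x₀ i])`, with exceptional set any finite `S₁` off which the base vector
survives, `[x₀ i] ≠ 0` — the «unramified vector» input.  This is the identification between a global object
presented as coinvariants of `⊗'_v` and one DEFINED as `⊗'_v` of local quotients ([Liu2021] Def. 4.11).
[cite: Flath1979, §2  Example 2] -/
theorem IsRestrictedTensorProductRep.isRestrictedTensorProduct_coinv {χloc : ∀ i, H i →* kˣ}
    {hq : ∀ᶠ i in cofinite, TwistedCoinv.mk (ρW i) (χloc i) (x₀ i) = TwistedCoinv.mk (ρW i) (χloc i) (x₀ i)}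
    (hσ : IsRestrictedTensorProductRep ρW σ hx₀ j S₀) (χ : (Πʳ i, [H i, KH i]) →* kˣ)
    (hχ : ∀ g : Πʳ i, [H i, KH i], ((χ g : kˣ) : k) = ∏ᶠ i, ((χloc i (g i) : kˣ) : k))
    (hχK : ∀ᶠ i in cofinite, ∀ g ∈ KH i, χloc i g = 1)
    {S₁ : Finset ι} (hx₀N : ∀ i ∉ S₁, TwistedCoinv.mk (ρW i) (χloc i) (x₀ i) ≠ 0)
    (J : RestrictedFamily (fun i => TwistedCoinv.Coinv (ρW i) (χloc i))
      (fun i => TwistedCoinv.mk (ρW i) (χloc i) (x₀ i)) → TwistedCoinv.Coinv σ χ)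
    (hJ : ∀ x : RestrictedFamily V x₀,
      J (RestrictedFamily.piMap (x₀' := fun i => TwistedCoinv.mk (ρW i) (χloc i) (x₀ i))
        (fun i => TwistedCoinv.mk (ρW i) (χloc i)) hq x) = TwistedCoinv.mk σ χ (j x)) :
    IsRestrictedTensorProduct k J S₁ :=
  hσ.isRestrictedTensorProduct.quotient (N := fun i => TwistedCoinv.ker (ρW i) (χloc i))
    (M := TwistedCoinv.ker σ χ) (hσ.ker_le_span χloc χ hχ hχK)
    (fun i hi hmem => hx₀N i hi ((Submodule.Quotient.mk_eq_zero _).2 hmem)) J hJ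

/-! ### §3 Equivariance under a second, commuting restricted product (the other member of a dual pair) -/

variable {G : ι → Type uG} [∀ i, Group (G i)] {K : ∀ i, Subgroup (G i)}
  {ρV : ∀ i, Representation k (G i) (V i)} {hx₀V : ∀ᶠ i in cofinite, x₀ i ∈ (ρV i).fixedPoints (K i)}
  {πV : Representation k (Πʳ i, [G i, K i]) W} {S₀' : Finset ι}

/-- **Two restricted tensor product representations on one model, built from slotwise commuting local families,
commute.** [cite: Flath1979, §2  Example 2] -/
theorem IsRestrictedTensorProductRep.commute (hπV : IsRestrictedTensorProductRep ρV πV hx₀V j S₀')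
    (hσ : IsRestrictedTensorProductRep ρW σ hx₀ j S₀)
    (hc : ∀ (i : ι) (g : G i) (h : H i), Commute (ρV i g) (ρW i h))
    (g : Πʳ i, [G i, K i]) (h : Πʳ i, [H i, KH i]) : Commute (πV g) (σ h) := by
  show πV g * σ h = σ h * πV g
  refine hπV.isRestrictedTensorProduct.linearMap_ext fun x => ?_
  rw [Module.End.mul_apply, Module.End.mul_apply, ← hσ.map_smul, ← hπV.map_smul, ← hπV.map_smul,
    ← hσ.map_smul]
  congr 1
  ext l
  simp only [RestrictedFamily.smul_apply]
  simpa only [Module.End.mul_apply] using LinearMap.congr_fun (hc l (g l) (h l)).eq (x l)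

omit [DecidableEq ι] in
/-- The base classes `[x₀ i]` are `K i`-fixed in the local coinvariants for almost all `i` (the hypothesis under
which the restricted product acts on restricted families of local coinvariant classes; Flath 1979, §2, Example 2).
[cite: Flath1979, §2  Example 2] -/
theorem IsRestrictedTensorProductRep.eventually_mk_mem_fixedPoints {χloc : ∀ i, H i →* kˣ}
    (hc : ∀ (i : ι) (g : G i) (h : H i), Commute (ρV i g) (ρW i h))
    (hx₀V : ∀ᶠ i in cofinite, x₀ i ∈ (ρV i).fixedPoints (K i)) :
    ∀ᶠ i in cofinite, TwistedCoinv.mk (ρW i) (χloc i) (x₀ i) ∈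
      (TwistedCoinv.rep (χloc i) (ρV i) (hc i)).fixedPoints (K i) :=
  hx₀V.mono fun i hi => by
    rw [Representation.mem_fixedPoints] at hi ⊢
    intro g hg
    rw [TwistedCoinv.rep_mk, hi g hg]

/-- **The identification is equivariant**: with a second restricted product `Πʳ i, [G i, K i]` acting on `W`
through `πV = ⊗'_i ρV i` for local families `ρV i` commuting with the `ρW i` (a dual pair, slot by slot), the
`χ`-coinvariants of `σ = ⊗'_i ρW i` with the induced action `TwistedCoinv.rep χ πV _`, together with `J`, ARE a
restricted tensor product of the local coinvariant representations `TwistedCoinv.rep (χloc i) (ρV i) _` (over a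
field; exceptional set any finite `S₁` off which `[x₀ i] ≠ 0`).  This is «`Coinv_{∏' H_v, χ} (⊗'_v S_v) ≅
⊗'_v Coinv_{H_v, χ_v} (S_v)` as `∏'_v G_v`-modules». [cite: Flath1979, §2  Example 2] -/
theorem IsRestrictedTensorProductRep.coinv {χloc : ∀ i, H i →* kˣ}
    {hq : ∀ᶠ i in cofinite, TwistedCoinv.mk (ρW i) (χloc i) (x₀ i) = TwistedCoinv.mk (ρW i) (χloc i) (x₀ i)}
    (hπV : IsRestrictedTensorProductRep ρV πV hx₀V j S₀')
    (hσ : IsRestrictedTensorProductRep ρW σ hx₀ j S₀)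
    (hc : ∀ (i : ι) (g : G i) (h : H i), Commute (ρV i g) (ρW i h))
    (hcomm : ∀ (g : Πʳ i, [G i, K i]) (h : Πʳ i, [H i, KH i]), Commute (πV g) (σ h))
    (χ : (Πʳ i, [H i, KH i]) →* kˣ)
    (hχ : ∀ g : Πʳ i, [H i, KH i], ((χ g : kˣ) : k) = ∏ᶠ i, ((χloc i (g i) : kˣ) : k))
    (hχK : ∀ᶠ i in cofinite, ∀ g ∈ KH i, χloc i g = 1)
    {S₁ : Finset ι} (hx₀N : ∀ i ∉ S₁, TwistedCoinv.mk (ρW i) (χloc i) (x₀ i) ≠ 0)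
    (hx₀' : ∀ᶠ i in cofinite, TwistedCoinv.mk (ρW i) (χloc i) (x₀ i) ∈
      (TwistedCoinv.rep (χloc i) (ρV i) (hc i)).fixedPoints (K i))
    (J : RestrictedFamily (fun i => TwistedCoinv.Coinv (ρW i) (χloc i))
      (fun i => TwistedCoinv.mk (ρW i) (χloc i) (x₀ i)) → TwistedCoinv.Coinv σ χ)
    (hJ : ∀ x : RestrictedFamily V x₀,
      J (RestrictedFamily.piMap (x₀' := fun i => TwistedCoinv.mk (ρW i) (χloc i) (x₀ i))
        (fun i => TwistedCoinv.mk (ρW i) (χloc i)) hq x) = TwistedCoinv.mk σ χ (j x)) :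
    IsRestrictedTensorProductRep (fun i => TwistedCoinv.rep (χloc i) (ρV i) (hc i))
      (TwistedCoinv.rep χ πV hcomm) hx₀' J S₁ := by
  refine ⟨hσ.isRestrictedTensorProduct_coinv χ hχ hχK hx₀N J hJ, fun g y => ?_⟩
  obtain ⟨x, hx⟩ := RestrictedFamily.piMap_mkQ_surjective (x₀ := x₀)
    (fun i => TwistedCoinv.ker (ρW i) (χloc i)) hq y
  have hx' : RestrictedFamily.piMap (x₀' := fun i => TwistedCoinv.mk (ρW i) (χloc i) (x₀ i))
      (fun i => TwistedCoinv.mk (ρW i) (χloc i)) hq x = y := hx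
  subst hx'
  have e : RestrictedFamily.smul (fun i => TwistedCoinv.rep (χloc i) (ρV i) (hc i)) hx₀' g
      (RestrictedFamily.piMap (x₀' := fun i => TwistedCoinv.mk (ρW i) (χloc i) (x₀ i))
        (fun i => TwistedCoinv.mk (ρW i) (χloc i)) hq x) =
      RestrictedFamily.piMap (x₀' := fun i => TwistedCoinv.mk (ρW i) (χloc i) (x₀ i))
        (fun i => TwistedCoinv.mk (ρW i) (χloc i)) hq (RestrictedFamily.smul ρV hx₀V g x) := by
    ext l
    simp only [RestrictedFamily.smul_apply, RestrictedFamily.piMap_apply, TwistedCoinv.rep_mk]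
  rw [e, hJ, hJ, hπV.map_smul, TwistedCoinv.rep_mk]

end CoinvField

end Literature.NumberTheory.Automorphic

end
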